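import Summits.QuantumFields.QCD.Theses.HeatSlicedQuarks
import Summits.QuantumFields.QCD.Theorems.HeatSlicedQuarksSmallFieldUltracontractivity
import Summits.QuantumFields.QCD.Theorems.HeatSlicedQuarksInterleavedHeatSliceFlowStubGammaFiveDiagonal
import Summits.QuantumFields.QCD.Theorems.HeatSlicedQuarksInterleavedFlowProperStubFrPiecesSFUAux
import Summits.QuantumFields.QCD.Theorems.SmallFieldUltracontractivity.Negative.LoadBearing
import Literature.LinearAlgebra.Matrix.FiniteRangeDecompositionMatrixBounds
import Literature.MathematicalPhysics.QuantumLattice.OverlapLocality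

/-!
# Crux `InterleavedFlowProper` (stmt-QuantumFields-18031), line `finite-range-heat-slices` —
# stub `stub_finiteRangeHeatSlices` (FORMAT 1), part 2: SFU power counting of the Bauerschmidt pieces on
# 8871-small balls — on-diagonal `C/4ⁿ`, sandwiched `C/16ⁿ + Cμ²/4ⁿ`

Registered helper `stub_frPiecesSFU` (spectral bound fixed at `Θ = 64`): clause (SFU power counting) of
`FRHeatSlices` of the skeleton `Cruxes/InterleavedFlowProper/Lines/finite_range_heat_slices.lean`.

Proof (spectral subordination of the pieces to heat kernels; the real analysis — the `s = 4` majorant of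
the scale functions, the discrete subordination `(1+y)^{-s} ≤ e² Σ_{j<N} (2^j)^{-s} e^{-y/2^j}` and the
scalar domination on the spectral window — is the companion file `…StubFrPiecesSFUAux.lean`):
* §B spectral linear algebra: `g(H + s) = g(· + s)(H)`, `A g(AᴴA) Aᴴ = (λ g(λ))(AAᴴ)`, the diagonal
  entries of `f(AᴴA)` as spectral averages and their domination by `Σ_j c_j Re e^{-t_j AᴴA}(i,i)`;
* §C the proved crux 8871 (`SmallFieldUltracontractivity_of`) in all regimes `0 < t ≤ r²`
  (entries `≤ 1` below `t = 1`);
* §E assembly on the window `λ ∈ [0, 81]` (`‖D_W‖ ≤ 9`), `μ² ≤ 1`, with `γ₅`-hermiticity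
  (`stub_gammaFiveDiagonal`) for the sandwiched operator `D_W C_n D_Wᴴ = (λ g_n(λ + μ²))(D_W D_Wᴴ)`.
-/

noncomputable section

namespace Summit.QuantumFields.QCD.Cruxes.InterleavedFlowProper.FiniteRangeHeatSlices

open scoped BigOperators Matrix ComplexOrder
open Filter Topology
open Literature.MathematicalPhysics.QuantumFieldTheory Literature.MathematicalPhysics.QuantumLattice
open Literature.Probability.LatticeModels (TorusSite)
open Literature.LinearAlgebra.Matrix (MatrixFRD.piece)

/-! ## §B Spectral linear algebra: shifts, sandwiches and subordination of matrix functions -/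

section Spectral

open Literature.LinearAlgebra.Matrix Polynomial
open Summit.QuantumFields.QCD.Theorems.SmallFieldUltracontractivity.Negative
open Summit.QuantumFields.QCD.Cruxes.SmallFieldUltracontractivity.PointCentredAxialParabolic

variable {ι : Type*} [Fintype ι] [DecidableEq ι]

/-- Mathlib's spectral theorem in product form: `H = U diag(λ) U*`. [folklore] -/
theorem eq_conj_diagonal_eigenvalues {H : Matrix ι ι ℂ} (hH : H.IsHermitian) :
    H = (hH.eigenvectorUnitary : Matrix ι ι ℂ) *
      Matrix.diagonal (fun k => (RCLike.ofReal (hH.eigenvalues k) : ℂ)) *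
        star (hH.eigenvectorUnitary : Matrix ι ι ℂ) := by
  conv_lhs => rw [hH.spectral_theorem, Unitary.conjStarAlgAut_apply]
  rfl

/-- **Spectral shift**: `g(H + s·1) = (λ ↦ g(λ + s))(H)` for Hermitian `H` and real `s`. [folklore] -/
theorem cfc_add_smul_one {H : Matrix ι ι ℂ} (hH : H.IsHermitian) (s : ℝ) (g : ℝ → ℝ) :
    cfc g (H + (s : ℂ) • (1 : Matrix ι ι ℂ)) = cfc (fun x => g (x + s)) H := by
  set U : Matrix ι ι ℂ := (hH.eigenvectorUnitary : Matrix ι ι ℂ) with hU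
  have hUmem : U ∈ Matrix.unitaryGroup ι ℂ := hH.eigenvectorUnitary.2
  have hspec : H = U * Matrix.diagonal (fun k => (RCLike.ofReal (hH.eigenvalues k) : ℂ)) * star U :=
    eq_conj_diagonal_eigenvalues hH
  have hUU : U * star U = 1 := Unitary.coe_mul_star_self hH.eigenvectorUnitary
  have hdiag : Matrix.diagonal (fun k => (RCLike.ofReal (hH.eigenvalues k + s) : ℂ)) =
      Matrix.diagonal (fun k => (RCLike.ofReal (hH.eigenvalues k) : ℂ)) +
        (s : ℂ) • (1 : Matrix ι ι ℂ) := by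
    rw [← Matrix.diagonal_one, ← Matrix.diagonal_smul, Matrix.diagonal_add]
    congr 1
    funext k
    simp
  have hspec' : H + (s : ℂ) • (1 : Matrix ι ι ℂ) =
      U * Matrix.diagonal (fun k => (RCLike.ofReal (hH.eigenvalues k + s) : ℂ)) * star U := by
    rw [hdiag, Matrix.mul_add, Matrix.add_mul, Matrix.mul_smul, Matrix.mul_one, Matrix.smul_mul,
      hUU, ← hspec]
  exact (cfc_eq_conj_diagonal hUmem hspec' g).trans
    (cfc_eq_conj_diagonal hUmem hspec (fun x => g (x + s))).symm

/-- `A (AᴴA)^k Aᴴ = (AAᴴ)^{k+1}`. [folklore] -/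
theorem mul_pow_conjTranspose_mul_self_mul (A : Matrix ι ι ℂ) (k : ℕ) :
    A * (Aᴴ * A) ^ k * Aᴴ = (A * Aᴴ) ^ (k + 1) := by
  induction k with
  | zero => rw [pow_zero, Matrix.mul_one, pow_one]
  | succ k ih =>
      rw [pow_succ, show A * ((Aᴴ * A) ^ k * (Aᴴ * A)) * Aᴴ = (A * (Aᴴ * A) ^ k * Aᴴ) * (A * Aᴴ) by
        simp only [Matrix.mul_assoc], ih, ← pow_succ]

/-- `A · p(AᴴA) · Aᴴ = (X·p)(AAᴴ)` for every real polynomial `p`. [folklore] -/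
theorem mul_aeval_conjTranspose_mul_self_mul (A : Matrix ι ι ℂ) (p : ℝ[X]) :
    A * aeval (Aᴴ * A) p * Aᴴ = aeval (A * Aᴴ) (X * p) := by
  induction p using Polynomial.induction_on' with
  | add p q hp hq => rw [map_add, Matrix.mul_add, Matrix.add_mul, hp, hq, mul_add, map_add]
  | monomial k c =>
      rw [X_mul_monomial, aeval_monomial, aeval_monomial, Algebra.algebraMap_eq_smul_one,
        smul_mul_assoc, smul_mul_assoc, one_mul, one_mul, Matrix.mul_smul, Matrix.smul_mul,
        mul_pow_conjTranspose_mul_self_mul]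

/-- **Sandwiching a function of `AᴴA`**: `A · g(AᴴA) · Aᴴ = (λ ↦ λ g(λ))(AAᴴ)` (interpolate `g` by a
polynomial on both spectra). [folklore] -/
theorem mul_cfc_conjTranspose_mul_self_mul (A : Matrix ι ι ℂ) (g : ℝ → ℝ) :
    A * cfc g (Aᴴ * A) * Aᴴ = cfc (fun x => x * g x) (A * Aᴴ) := by
  have hH : (Aᴴ * A).IsHermitian := (Matrix.posSemidef_conjTranspose_mul_self A).isHermitian
  have hH' : (A * Aᴴ).IsHermitian := (Matrix.posSemidef_self_mul_conjTranspose A).isHermitian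
  obtain ⟨p, hp⟩ := exists_polynomial_eval_eq (spectrum ℝ (Aᴴ * A) ∪ spectrum ℝ (A * Aᴴ))
    (Matrix.finite_real_spectrum.union Matrix.finite_real_spectrum) g
  rw [cfc_eq_aeval_of_eval_eq hH g p (fun x hx => hp x (Set.mem_union_left _ hx)),
    cfc_eq_aeval_of_eval_eq hH' (fun x => x * g x) (X * p) (fun x hx => by
      rw [eval_mul, eval_X, hp x (Set.mem_union_right _ hx)]),
    mul_aeval_conjTranspose_mul_self_mul]

/-- The diagonal entry of a real function of `AᴴA` is the real number `Σ_k ‖U i k‖² f(λ_k)`.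
[folklore] -/
theorem cfc_apply_self_eq_sum (A : Matrix ι ι ℂ) (hH : (Aᴴ * A).IsHermitian) (f : ℝ → ℝ) (i : ι) :
    cfc f (Aᴴ * A) i i =
      ((∑ k, ‖(hH.eigenvectorUnitary : Matrix ι ι ℂ) i k‖ ^ 2 * f (hH.eigenvalues k) : ℝ) : ℂ) := by
  rw [cfc_apply_eq_sum hH.eigenvectorUnitary.2 (eq_conj_diagonal_eigenvalues hH) f i i,
    Complex.ofReal_sum]
  refine Finset.sum_congr rfl fun k _ => ?_
  rw [mul_right_comm, Complex.star_def, Complex.mul_conj, Complex.normSq_eq_norm_sq,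
    RCLike.ofReal_eq_complex_ofReal]
  push_cast
  ring

open scoped Matrix.Norms.L2Operator in
/-- The eigenvalues of `AᴴA` lie in `[0, ‖A‖²]` (`ℓ²` operator norm). [folklore] -/
theorem eigenvalues_conjTranspose_mul_self_mem (A : Matrix ι ι ℂ) (hH : (Aᴴ * A).IsHermitian)
    (i k : ι) : 0 ≤ hH.eigenvalues k ∧ hH.eigenvalues k ≤ ‖A‖ ^ 2 := by
  have _ := i
  refine ⟨(Matrix.posSemidef_conjTranspose_mul_self A).eigenvalues_nonneg k, ?_⟩
  haveI : Nonempty ι := ⟨i⟩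
  have hk : ((hH.eigenvalues k : ℝ) : ℂ) ∈ spectrum ℂ (Aᴴ * A) :=
    (spectrum.algebraMap_mem_iff ℂ).mpr (hH.eigenvalues_mem_spectrum_real k)
  have h1 := spectrum.norm_le_norm_of_mem hk
  rw [Complex.norm_real, Real.norm_eq_abs, Matrix.l2_opNorm_conjTranspose_mul_self, ← sq] at h1
  exact (le_abs_self _).trans h1

open scoped Matrix.Norms.L2Operator in
/-- **Spectral subordination of a matrix function to heat kernels (diagonal entries).**  If
`0 ≤ f(λ) ≤ a + b Σ_{j<N} c_j e^{-t_j λ}` on `[0, Λ] ⊇ [0, ‖A‖²]` (`b, c_j ≥ 0`), then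
`‖f(AᴴA)(i,i)‖ ≤ a + b Σ_{j<N} c_j Re e^{-t_j AᴴA}(i,i)`: both sides are averages against the same
spectral weights `‖U i k‖²` (summing to one). [folklore] -/
theorem norm_cfc_apply_self_le (A : Matrix ι ι ℂ) (i : ι) (f : ℝ → ℝ) {a b Λ : ℝ} {N : ℕ}
    {c t : ℕ → ℝ} (hf0 : ∀ x, 0 ≤ x → 0 ≤ f x) (hb : 0 ≤ b) (hc : ∀ j, 0 ≤ c j)
    (hA : ‖A‖ ^ 2 ≤ Λ)
    (hf : ∀ x, 0 ≤ x → x ≤ Λ →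
      f x ≤ a + b * ∑ j ∈ Finset.range N, c j * Real.exp (-(t j * x))) :
    ‖cfc f (Aᴴ * A) i i‖ ≤
      a + b * ∑ j ∈ Finset.range N, c j * ((NormedSpace.exp (-(t j : ℂ) • (Aᴴ * A))) i i).re := by
  have _ := hb
  have _ := hc
  have hP : (Aᴴ * A).PosSemidef := Matrix.posSemidef_conjTranspose_mul_self A
  have hH : (Aᴴ * A).IsHermitian := hP.isHermitian
  set U : Matrix ι ι ℂ := (hH.eigenvectorUnitary : Matrix ι ι ℂ) with hU
  have hUmem : U ∈ Matrix.unitaryGroup ι ℂ := hH.eigenvectorUnitary.2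
  have hev : ∀ k, 0 ≤ hH.eigenvalues k ∧ hH.eigenvalues k ≤ Λ := fun k =>
    ⟨(eigenvalues_conjTranspose_mul_self_mem A hH i k).1,
      (eigenvalues_conjTranspose_mul_self_mem A hH i k).2.trans hA⟩
  have hsum0 : 0 ≤ ∑ k, ‖U i k‖ ^ 2 * f (hH.eigenvalues k) :=
    Finset.sum_nonneg fun k _ => mul_nonneg (sq_nonneg _) (hf0 _ (hev k).1)
  rw [cfc_apply_self_eq_sum A hH f i, Complex.norm_real, Real.norm_eq_abs, abs_of_nonneg hsum0]
  have hS : ∀ j, ((NormedSpace.exp (-(t j : ℂ) • (Aᴴ * A))) i i).re =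
      ∑ k, ‖U i k‖ ^ 2 * Real.exp (-(t j * hH.eigenvalues k)) :=
    fun j => re_exp_neg_smul_apply_self_eq_sum A hH (t j) i
  simp_rw [hS]
  have hrow : ∑ k, ‖U i k‖ ^ 2 = 1 := unitary_row_norm_sq U hUmem i
  calc ∑ k, ‖U i k‖ ^ 2 * f (hH.eigenvalues k)
      ≤ ∑ k, ‖U i k‖ ^ 2 *
          (a + b * ∑ j ∈ Finset.range N, c j * Real.exp (-(t j * hH.eigenvalues k))) :=
        Finset.sum_le_sum fun k _ =>
          mul_le_mul_of_nonneg_left (hf _ (hev k).1 (hev k).2) (sq_nonneg _)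
    _ = a * ∑ k, ‖U i k‖ ^ 2 + b * ∑ j ∈ Finset.range N, c j *
          ∑ k, ‖U i k‖ ^ 2 * Real.exp (-(t j * hH.eigenvalues k)) := by
        simp only [mul_add, Finset.sum_add_distrib, Finset.mul_sum]
        congr 1
        · exact Finset.sum_congr rfl fun k _ => by ring
        · rw [Finset.sum_comm]
          exact Finset.sum_congr rfl fun j _ => Finset.sum_congr rfl fun k _ => by ring
    _ = _ := by rw [hrow, mul_one]

end Spectral

/-! ## §C The heat-kernel input: the proved crux 8871 in all three regimes `0 < t ≤ r²` -/

section Heat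

/-- **8871 for all `0 < t ≤ r²`**: with the `ε, K` of `SmallFieldUltracontractivity_of` and
`C' = max C 1 ≥ 1`, the on-diagonal real parts obey `Re e^{-tH_U}(η,η) ≤ C'/t²` for `0 < t ≤ r²`
(for `t < 1` every entry is `≤ 1 ≤ 1/t²`). -/
theorem heat_diag_bound :
    ∃ ε : ℝ, 0 < ε ∧ ∃ K : ℕ, ∃ C : ℝ, 1 ≤ C ∧
      ∀ (L : ℕ) [NeZero L] (U : GaugeConfig 4 L (Matrix.specialUnitaryGroup (Fin 3) ℂ)) (m : ℝ),
        m ∈ Set.Icc (-(1 / 2 : ℝ)) 1 → ∀ (x : TorusSite 4 L) (r : ℕ), 1 ≤ r → r ≤ L →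
        (∀ y : TorusSite 4 L, torusDist x y ≤ K * r → ∀ μ ν : Fin 4,
          3 - ((fundamentalRep (Fin 3)) (plaquetteHolonomy U y μ ν)).trace.re ≤ (ε / (r : ℝ) ^ 2) ^ 2) →
        ∀ t : ℝ, 0 < t → t ≤ (r : ℝ) ^ 2 → ∀ (a : Fin 3) (α : Fin 4),
          ((NormedSpace.exp (-(t : ℂ) •
            ((wilsonDirac (fundamentalRep (Fin 3)) U m 1)ᴴ * wilsonDirac (fundamentalRep (Fin 3)) U m 1)))
            (x, a, α) (x, a, α)).re ≤ C / t ^ 2 := by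
  obtain ⟨ε, hε, K, C, hC⟩ :=
    Summit.QuantumFields.QCD.Cruxes.SmallFieldUltracontractivity.PointCentredAxialParabolic.SmallFieldUltracontractivity_of
  refine ⟨ε, hε, K, max C 1, le_max_right _ _, ?_⟩
  intro L _ U m hm x r hr hrL hsmall t ht htr a α
  set D := wilsonDirac (fundamentalRep (Fin 3)) U m 1 with hD
  have ht2 : 0 < t ^ 2 := by positivity
  by_cases h1 : 1 ≤ t
  · have h := hC L U m hm x r hr hrL hsmall t h1 htr a a α α
    calc ((NormedSpace.exp (-(t : ℂ) • (Dᴴ * D))) (x, a, α) (x, a, α)).re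
        ≤ ‖(NormedSpace.exp (-(t : ℂ) • (Dᴴ * D))) (x, a, α) (x, a, α)‖ := Complex.re_le_norm _
      _ ≤ C / t ^ 2 := h
      _ ≤ max C 1 / t ^ 2 := div_le_div_of_nonneg_right (le_max_left _ _) ht2.le
  · have ht1 : t ^ 2 ≤ 1 := pow_le_one₀ ht.le (le_of_lt (not_le.mp h1))
    calc ((NormedSpace.exp (-(t : ℂ) • (Dᴴ * D))) (x, a, α) (x, a, α)).re
        ≤ ‖(NormedSpace.exp (-(t : ℂ) • (Dᴴ * D))) (x, a, α) (x, a, α)‖ := Complex.re_le_norm _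
      _ ≤ 1 := Summit.QuantumFields.QCD.Theorems.SmallFieldUltracontractivity.Negative.norm_exp_neg_smul_conjTranspose_mul_self_apply_le_one D ht.le _ _
      _ ≤ max C 1 / t ^ 2 := by
          rw [le_div_iff₀ ht2]
          nlinarith [le_max_right C 1]

end Heat

/-! ## §E Assembly -/

open scoped Matrix.Norms.L2Operator in
/-- **Finite-range heat slices, part 2 (SFU power counting)**: there are `ε > 0`, `K`, `C` such that for
`μ ∈ (0,1]`, every torus, `SU(3)` field `U`, `m ∈ [−1/2,1]`, `Q = D_Wᴴ D_W + μ²`, every `n`, site `x` and scale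
`2ⁿ ≤ r ≤ L` at which all plaquettes in the ball of radius `K r` about `x` are `(ε/r²)²`-small (the hypothesis of
the proved crux 8871 `SmallFieldUltracontractivity`), the on-diagonal entries of the piece
`C_n = MatrixFRD.piece Q 64 2 n` are `≤ C/4ⁿ` and those of the sandwiched piece `D_W C_n D_Wᴴ` are
`≤ C/16ⁿ + C μ²/4ⁿ` — free Dirac power counting of the slice (8871 at heat times `4^{n-j}` by subordination of the
`P_t`-lemma majorant `(1 + t²λ)^{-4}` to heat kernels, diagonal entries `≤ 1` below `t = 1`, monotonicity beyond
`t = r²`, `γ₅`-hermiticity for the sandwiched operator). [Bauerschmidt2013 Thm 1.2; BBS LNM 2242 Ch. 3; item 8871] -/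
theorem stub_frPiecesSFU :
    ∃ ε : ℝ, 0 < ε ∧ ∃ K : ℕ, ∃ C : ℝ, ∀ μ : ℝ, μ ∈ Set.Ioc (0 : ℝ) 1 →
      ∀ (L : ℕ) [NeZero L] (U : GaugeConfig 4 L (Matrix.specialUnitaryGroup (Fin 3) ℂ)) (m : ℝ),
        m ∈ Set.Icc (-(1 / 2 : ℝ)) 1 →
        ∀ Q : Matrix (TorusSite 4 L × Fin 3 × Fin 4) (TorusSite 4 L × Fin 3 × Fin 4) ℂ,
          Q = (wilsonDirac (fundamentalRep (Fin 3)) U m 1)ᴴ * wilsonDirac (fundamentalRep (Fin 3)) U m 1 +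
            ((μ : ℂ) ^ 2) • (1 : Matrix (TorusSite 4 L × Fin 3 × Fin 4) (TorusSite 4 L × Fin 3 × Fin 4) ℂ) →
          ∀ (n : ℕ) (x : TorusSite 4 L) (r : ℕ), 2 ^ n ≤ r → r ≤ L →
            (∀ y : TorusSite 4 L, torusDist x y ≤ K * r → ∀ μ' ν' : Fin 4,
              3 - ((fundamentalRep (Fin 3)) (plaquetteHolonomy U y μ' ν')).trace.re ≤ (ε / (r : ℝ) ^ 2) ^ 2) →
            ∀ (a : Fin 3) (α : Fin 4),
              ‖MatrixFRD.piece Q (64 : ℝ) 2 n (x, a, α) (x, a, α)‖ ≤ C / 4 ^ n ∧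
              ‖(wilsonDirac (fundamentalRep (Fin 3)) U m 1 * MatrixFRD.piece Q (64 : ℝ) 2 n *
                  (wilsonDirac (fundamentalRep (Fin 3)) U m 1)ᴴ) (x, a, α) (x, a, α)‖ ≤
                C / 16 ^ n + C * μ ^ 2 / 4 ^ n := by
  obtain ⟨ε, hε, K, C₈, hC₈, hheat⟩ := heat_diag_bound
  obtain ⟨K₄, hK₄pos, hmaj⟩ := stub_frPiecesSFUMajorantFour
  have hK₄ : 0 ≤ K₄ := hK₄pos.le
  refine ⟨ε, hε, K, 21 * K₄ + 8 * 1024 ^ 2 * Real.exp 2 * K₄ * C₈, ?_⟩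
  intro μ hμ L _ U m hm Q hQ n x r hr hrL hsmall a α
  set D := wilsonDirac (fundamentalRep (Fin 3)) U m 1 with hD
  set C : ℝ := 21 * K₄ + 8 * 1024 ^ 2 * Real.exp 2 * K₄ * C₈ with hCdef
  have hC₈0 : 0 ≤ C₈ := zero_le_one.trans hC₈
  have hP : 0 ≤ Real.exp 2 * K₄ * C₈ := mul_nonneg (mul_nonneg (Real.exp_pos 2).le hK₄) hC₈0
  have hC0 : 0 ≤ C := by rw [hCdef]; nlinarith
  have hμ0 : 0 ≤ μ ^ 2 := sq_nonneg μ
  have hμ1 : μ ^ 2 ≤ 1 := pow_le_one₀ hμ.1.le hμ.2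
  -- the scales `t_j = 4ⁿ/1024/2ʲ ∈ (0, r²]`
  have hr1 : 1 ≤ r := le_trans Nat.one_le_two_pow hr
  have h4pos : (0:ℝ) < 4 ^ n := by positivity
  have h4r : (4:ℝ) ^ n ≤ (r:ℝ) ^ 2 := by
    have h' : ((2 ^ n : ℕ) : ℝ) ≤ r := by exact_mod_cast hr
    have h2 : ((2:ℝ) ^ n) ^ 2 = 4 ^ n := by rw [← pow_mul, pow_mul']; norm_num
    rw [← h2]
    push_cast at h'
    gcongr
  have ht : ∀ j : ℕ, 0 < (4:ℝ) ^ n / 1024 / 2 ^ j ∧ (4:ℝ) ^ n / 1024 / 2 ^ j ≤ (r:ℝ) ^ 2 := fun j => by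
    refine ⟨by positivity, le_trans ?_ h4r⟩
    calc (4:ℝ) ^ n / 1024 / 2 ^ j ≤ 4 ^ n / 1024 :=
          div_le_self (by positivity) (one_le_pow₀ (by norm_num))
      _ ≤ 4 ^ n := div_le_self (by positivity) (by norm_num)
  have hS : ∀ j : ℕ, ((NormedSpace.exp (-(((4:ℝ) ^ n / 1024 / 2 ^ j : ℝ) : ℂ) • (Dᴴ * D)))
      (x, a, α) (x, a, α)).re ≤ C₈ / ((4:ℝ) ^ n / 1024 / 2 ^ j) ^ 2 :=
    fun j => hheat L U m hm x r hr1 hrL hsmall _ (ht j).1 (ht j).2 a α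
  have hSb : ∀ j : ℕ, (0:ℝ) ≤ (((2:ℝ) ^ j) ^ 2)⁻¹ := fun j => by positivity
  -- the norm of `D_W`
  have hDn : ‖D‖ ^ 2 ≤ 81 := by
    have h := l2_opNorm_wilsonDirac_le (fundamentalRep (Fin 3)) fundamentalRep_mem_unitaryGroup U m
    have h9 : ‖D‖ ≤ 9 := h.trans (by rw [abs_of_nonneg (by linarith [hm.1])]; linarith [hm.2])
    nlinarith [norm_nonneg D]
  have hDn' : ‖Dᴴ‖ ^ 2 ≤ 81 := by rwa [Matrix.l2_opNorm_conjTranspose]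
  -- the piece as a function of `H_U = D_Wᴴ D_W`
  have hHD : (Dᴴ * D).IsHermitian := (Matrix.posSemidef_conjTranspose_mul_self D).isHermitian
  have hpiece : MatrixFRD.piece Q (64 : ℝ) 2 n =
      cfc (fun z => Literature.LinearAlgebra.Matrix.MatrixFRD.gFun 64 2 n (z + μ ^ 2)) (Dᴴ * D) := by
    rw [MatrixFRD.piece, hQ, show ((μ : ℂ) ^ 2) = ((μ ^ 2 : ℝ) : ℂ) by push_cast; rfl]
    exact cfc_add_smul_one hHD (μ ^ 2) _
  have hind : (if n = 1 then (1:ℝ) else 0) ≤ 4 / 4 ^ n := by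
    split_ifs with h
    · subst h; norm_num
    · positivity
  have hind' : (if n = 1 then (1:ℝ) else 0) ≤ 16 / ((4:ℝ) ^ n) ^ 2 := by
    split_ifs with h
    · subst h; norm_num
    · positivity
  refine ⟨?_, ?_⟩
  · -- the diagonal claim
    rw [hpiece]
    have key := norm_cfc_apply_self_le D (x, a, α)
      (fun z => Literature.LinearAlgebra.Matrix.MatrixFRD.gFun 64 2 n (z + μ ^ 2))
      (a := K₄ / 64 * (if n = 1 then (1:ℝ) else 0)) (b := Real.exp 2 * (K₄ / 256) * 4 ^ n)
      (Λ := 81) (N := 2 * n + 1) (c := fun j => (((2:ℝ) ^ j) ^ 4)⁻¹)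
      (t := fun j => (4:ℝ) ^ n / 1024 / 2 ^ j)
      (fun z _ => Literature.LinearAlgebra.Matrix.MatrixFRD.gFun_nonneg (by norm_num) (by norm_num) n _)
      (by positivity) (fun j => by positivity) hDn
      (fun z hz hz81 => scalar_diag_le hK₄ hmaj n hz hz81 hμ0 hμ1)
    refine key.trans ?_
    have hsum : ∑ j ∈ Finset.range (2 * n + 1), (((2:ℝ) ^ j) ^ 4)⁻¹ *
        ((NormedSpace.exp (-(((4:ℝ) ^ n / 1024 / 2 ^ j : ℝ) : ℂ) • (Dᴴ * D))) (x, a, α) (x, a, α)).re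
          ≤ C₈ * 1024 ^ 2 / ((4:ℝ) ^ n) ^ 2 * (4 / 3) := by
      calc _ ≤ ∑ j ∈ Finset.range (2 * n + 1), C₈ * 1024 ^ 2 / ((4:ℝ) ^ n) ^ 2 * (((2:ℝ) ^ j) ^ 2)⁻¹ := by
            refine Finset.sum_le_sum fun j _ => ?_
            calc _ ≤ (((2:ℝ) ^ j) ^ 4)⁻¹ * (C₈ / ((4:ℝ) ^ n / 1024 / 2 ^ j) ^ 2) :=
                  mul_le_mul_of_nonneg_left (hS j) (by positivity)
              _ = C₈ * 1024 ^ 2 / ((4:ℝ) ^ n) ^ 2 * (((2:ℝ) ^ j) ^ 2)⁻¹ := by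
                  field_simp
        _ = C₈ * 1024 ^ 2 / ((4:ℝ) ^ n) ^ 2 * ∑ j ∈ Finset.range (2 * n + 1), (((2:ℝ) ^ j) ^ 2)⁻¹ := by
            rw [Finset.mul_sum]
        _ ≤ C₈ * 1024 ^ 2 / ((4:ℝ) ^ n) ^ 2 * (4 / 3) :=
            mul_le_mul_of_nonneg_left (sum_inv_pow_two_sq_le _) (by positivity)
    calc _ ≤ K₄ / 64 * (4 / 4 ^ n) +
          Real.exp 2 * (K₄ / 256) * 4 ^ n * (C₈ * 1024 ^ 2 / ((4:ℝ) ^ n) ^ 2 * (4 / 3)) := by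
          gcongr
      _ = (K₄ / 16 + Real.exp 2 * K₄ * C₈ * (1024 ^ 2 / 256 * (4 / 3))) / 4 ^ n := by
          field_simp
          ring
      _ ≤ C / 4 ^ n := by
          apply div_le_div_of_nonneg_right _ h4pos.le
          rw [hCdef]
          nlinarith
  · -- the sandwiched claim
    rw [hpiece, mul_cfc_conjTranspose_mul_self_mul D]
    have key := norm_cfc_apply_self_le Dᴴ (x, a, α)
      (fun z => z * Literature.LinearAlgebra.Matrix.MatrixFRD.gFun 64 2 n (z + μ ^ 2))
      (a := 81 * (K₄ / 64 * (if n = 1 then (1:ℝ) else 0))) (b := Real.exp 2 * (4 * K₄))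
      (Λ := 81) (N := 2 * n + 1) (c := fun j => (((2:ℝ) ^ j) ^ 3)⁻¹)
      (t := fun j => (4:ℝ) ^ n / 1024 / 2 ^ j)
      (fun z hz => mul_nonneg hz
        (Literature.LinearAlgebra.Matrix.MatrixFRD.gFun_nonneg (by norm_num) (by norm_num) n _))
      (by positivity) (fun j => by positivity) hDn'
      (fun z hz hz81 => scalar_sand_le hK₄ hmaj n hz hz81 hμ0 hμ1)
    rw [Matrix.conjTranspose_conjTranspose] at key
    have hγ5 : ∀ t : ℝ, (NormedSpace.exp (-(t : ℂ) • (D * Dᴴ))) (x, a, α) (x, a, α) =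
        (NormedSpace.exp (-(t : ℂ) • (Dᴴ * D))) (x, a, α) (x, a, α) := fun t =>
      Summit.QuantumFields.QCD.Cruxes.InterleavedHeatSliceFlow.Sketch.stub_gammaFiveDiagonal L U m t (x, a, α)
    simp_rw [hγ5] at key
    refine key.trans ?_
    have hsum : ∑ j ∈ Finset.range (2 * n + 1), (((2:ℝ) ^ j) ^ 3)⁻¹ *
        ((NormedSpace.exp (-(((4:ℝ) ^ n / 1024 / 2 ^ j : ℝ) : ℂ) • (Dᴴ * D))) (x, a, α) (x, a, α)).re
          ≤ C₈ * 1024 ^ 2 / ((4:ℝ) ^ n) ^ 2 * 2 := by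
      calc _ ≤ ∑ j ∈ Finset.range (2 * n + 1), C₈ * 1024 ^ 2 / ((4:ℝ) ^ n) ^ 2 * ((2:ℝ) ^ j)⁻¹ := by
            refine Finset.sum_le_sum fun j _ => ?_
            calc _ ≤ (((2:ℝ) ^ j) ^ 3)⁻¹ * (C₈ / ((4:ℝ) ^ n / 1024 / 2 ^ j) ^ 2) :=
                  mul_le_mul_of_nonneg_left (hS j) (by positivity)
              _ = C₈ * 1024 ^ 2 / ((4:ℝ) ^ n) ^ 2 * ((2:ℝ) ^ j)⁻¹ := by
                  field_simp
        _ = C₈ * 1024 ^ 2 / ((4:ℝ) ^ n) ^ 2 * ∑ j ∈ Finset.range (2 * n + 1), ((2:ℝ) ^ j)⁻¹ := by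
            rw [Finset.mul_sum]
        _ ≤ C₈ * 1024 ^ 2 / ((4:ℝ) ^ n) ^ 2 * 2 :=
            mul_le_mul_of_nonneg_left (sum_inv_pow_two_le _) (by positivity)
    have h16 : (16:ℝ) ^ n = ((4:ℝ) ^ n) ^ 2 := by rw [← pow_mul, pow_mul']; norm_num
    have hsq : (0:ℝ) < ((4:ℝ) ^ n) ^ 2 := by positivity
    calc _ ≤ 81 * (K₄ / 64 * (16 / ((4:ℝ) ^ n) ^ 2)) +
          Real.exp 2 * (4 * K₄) * (C₈ * 1024 ^ 2 / ((4:ℝ) ^ n) ^ 2 * 2) := by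
          gcongr
      _ = (81 / 4 * K₄ + 8 * 1024 ^ 2 * Real.exp 2 * K₄ * C₈) / ((4:ℝ) ^ n) ^ 2 := by
          field_simp
          ring
      _ ≤ C / ((4:ℝ) ^ n) ^ 2 := by
          apply div_le_div_of_nonneg_right _ hsq.le
          rw [hCdef]
          nlinarith
      _ = C / 16 ^ n := by rw [h16]
      _ ≤ C / 16 ^ n + C * μ ^ 2 / 4 ^ n := le_add_of_nonneg_right (by positivity)

end Summit.QuantumFields.QCD.Cruxes.InterleavedFlowProper.FiniteRangeHeatSlices

end
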